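import Literature.NumberTheory.Sieve.LargestPrimeFactorCubicSetup
import Literature.NumberTheory.Sieve.LargestPrimeFactorCubicRoots
import HarnessLib

/-!
# Heath-Brown 2001, §4 for `S₁`: the remainder sum reorganised by sieve divisor, `𝒦`-prime,
# cube, pair `(a, b)` and root class of `c` ((4.4), (5.1))

Twelfth proved layer of this seat under the named fact `HeathBrown2001_largestPrimeFactor_cubic`
(`LargestPrimeFactorCubic.lean`; D. R. Heath-Brown, *The largest prime factor of `X³ + 2`*, Proc.
London Math. Soc. (3) 82 (2001) 554–596).  §4 ("Preliminary transformation of the sums `S₀` and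
`S₁`", pp. 569–571) expands the sieve weights and reorders:

> `S₁ = ∑_K ∑_{A ∣ R} λ_{N(A)} ρ(KA) ∑_{L ∈ 𝓛(K), A ∣ L, (KA, q) = 1} R_{N(KL)}` … "we proceed to
> investigate the innermost sums above, by putting `KL = (a + b∛2 + c∛4)` and summing over `c` for
> fixed `a, b`" … (4.2) `c ∈ 𝒞, KA ∣ a + b∛2 + c∛4, …`, "equivalent to a congruence
> `c ≡ c₁(a, b, KA) (mod N(KA))`", whence (5.1) `S₁ ≪ ∑_K ∑_{N(A) ≤ X^{3δ}} ∑_{a,b} ∑ |∑_c R(α)|`.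

In the rational currency of `…Setup` (pairs `(α, p)`, `p = N(K)`; sieve divisors `d = N(A)`; the
ideals `KA` of norm `e = pd` with `ρ(KA) = 1` ↔ cube roots `j` of `2` modulo `e`, `…Roots`) this
file PROVES the corresponding EXACT identity and the resulting bound:

* `S1sum_eq` —
  `S₁ = ∑_{d ∣ Q} λ_d ∑_{p ∈ 𝒦} ∑_{i} ∑_{(a,b) ∈ P_i} ∑_{j < pd, j³ ≡ 2 (pd)} ∑_{c ∈ 𝒞(a,b), pd ∣ a+bj+cj²} R_{(a,b,c)}`,
  `R_α = #𝒜_{(α)} − X/N(α)` (`Rv`);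
* `abs_S1sum_le` — `|S₁| ≤ ∑_{d ∣ Q} |λ_d| ∑_p ∑_i ∑_{(a,b)} ∑_j |∑_{c : pd ∣ a+bj+cj²} R_{(a,b,c)}|`
  ((5.1); the coprimality conditions (2.11) on `c` stay inside `𝒞(a, b) = cSet`, to be handled
  in the estimation of the inner sums — see the module docstring of `…Setup`).

Ingredients: `∑_{d ∣ (m, Q)} = ∑_{d ∣ Q, d ∣ m}`; `p ∣ N ∧ d ∣ N/p ↔ pd ∣ N`; the generator set is
the disjoint union of its cubes and pairs (`sum_gens_eq`); and `…Roots.sum_filter_dvd_absNorm_eq`.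

## References

* D. R. Heath-Brown, *The largest prime factor of `X³ + 2`*, Proc. London Math. Soc. (3) 82 (2001)
  554–596, §4 pp. 569–571 ((4.2)–(4.4)) and (5.1). [`HeathBrown2001LargestPrimeFactorCubic`]
-/

noncomputable section

open NumberField Finset Real

namespace Literature.NumberTheory.Sieve.LargestPrimeFactorCubic

open LFunctions.CubeRootTwoField CubicSieve BetaSieve

/-- The remainder `R_α = #𝒜_{(α)} − X/N(α)` of a generator.
[cite: HeathBrown2001LargestPrimeFactorCubic, §2 p. 557] -/
def Rv (X : ℕ) (v : ℕ × ℕ × ℕ) : ℝ := (Acount X v : ℝ) - X / normNat v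

/-- The cube roots of `2` modulo `e` (representatives `j < e`): the root classes of the ideals of
norm `e` with `ρ = 1`. [cite: HeathBrown2001LargestPrimeFactorCubic, §4 p. 570] -/
def roots (e : ℕ) : Finset ℕ := (range e).filter fun j : ℕ => (e : ℤ) ∣ (j : ℤ) ^ 3 - 2

/-! ### Step 1: expanding the sieve weight -/

/-- The divisors of `(m, Q)` are the divisors of `Q` dividing `m`. [folklore] -/
theorem divisors_gcd_eq_filter (m : ℕ) {Q : ℕ} (hQ : Q ≠ 0) :
    (m.gcd Q).divisors = Q.divisors.filter (· ∣ m) := by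
  ext d
  simp only [Nat.mem_divisors, mem_filter, Nat.dvd_gcd_iff, ne_eq, Nat.gcd_eq_zero_iff, not_and]
  constructor
  · rintro ⟨⟨h1, h2⟩, -⟩; exact ⟨⟨h2, hQ⟩, h1⟩
  · rintro ⟨⟨h2, -⟩, h1⟩; exact ⟨⟨h1, h2⟩, fun _ => hQ⟩

/-- **Step 1** (p. 569): `S₁ = ∑_{d ∣ Q} λ_d ∑_{(α,p) : d ∣ N(α)/p} R_α`.
[cite: HeathBrown2001LargestPrimeFactorCubic, §4 p. 569] -/
theorem S1sum_eq_sum_divisors (X : ℕ) (P : ℕ → Finset (ℕ × ℕ)) :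
    S1sum X P = ∑ d ∈ (sievePrimes X).divisors, lam X d *
      ∑ vp ∈ (pairsVP X P).filter (fun vp => d ∣ normNat vp.1 / vp.2), Rv X vp.1 := by
  have hQ : sievePrimes X ≠ 0 := primesProdBelow_ne_zero _
  unfold S1sum
  have h1 : ∀ vp ∈ pairsVP X P, wt X vp.1 vp.2 * ((Acount X vp.1 : ℝ) - X / normNat vp.1) =
      ∑ d ∈ (sievePrimes X).divisors,
        if d ∣ normNat vp.1 / vp.2 then lam X d * Rv X vp.1 else 0 := by
    intro vp _
    rw [wt, divisors_gcd_eq_filter _ hQ, sum_filter, sum_mul]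
    refine sum_congr rfl (fun d _ => ?_)
    split_ifs <;> simp [Rv]
  rw [sum_congr rfl h1, sum_comm]
  refine sum_congr rfl (fun d _ => ?_)
  rw [sum_filter, mul_sum]
  refine sum_congr rfl (fun vp _ => ?_)
  split_ifs <;> simp

/-! ### Step 2: `p ∣ N ∧ d ∣ N/p ↔ pd ∣ N` -/

/-- `p ∣ N ∧ d ∣ N/p ↔ pd ∣ N`. [folklore] -/
theorem dvd_and_dvd_div_iff (p d N : ℕ) : p ∣ N ∧ d ∣ N / p ↔ p * d ∣ N := by
  constructor
  · rintro ⟨h1, h2⟩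
    exact (Nat.dvd_div_iff_mul_dvd h1).1 h2
  · intro h
    have h1 : p ∣ N := (dvd_mul_right p d).trans h
    exact ⟨h1, (Nat.dvd_div_iff_mul_dvd h1).2 h⟩

/-- **Step 2** (p. 569): for each sieve divisor `d`,
`∑_{(α,p) : d ∣ N(α)/p} R_α = ∑_{p ∈ 𝒦} ∑_{α ∈ gens, pd ∣ N(α)} R_α`.
[cite: HeathBrown2001LargestPrimeFactorCubic, §4 p. 569] -/
theorem sum_pairsVP_filter_eq (X : ℕ) (P : ℕ → Finset (ℕ × ℕ)) (d : ℕ) (g : ℕ × ℕ × ℕ → ℝ) :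
    ∑ vp ∈ (pairsVP X P).filter (fun vp => d ∣ normNat vp.1 / vp.2), g vp.1 =
      ∑ p ∈ kPrimes X, ∑ v ∈ (gens X P).filter (fun v => p * d ∣ normNat v), g v := by
  rw [pairsVP, filter_filter, sum_filter, sum_product, sum_comm]
  refine sum_congr rfl (fun p _ => ?_)
  rw [sum_filter]
  refine sum_congr rfl (fun v _ => ?_)
  simp only [dvd_and_dvd_div_iff]

/-! ### Step 3: the generator set as a disjoint union of its cubes and pairs -/

/-- The cubes at different admissible scales have disjoint `a`-ranges. [folklore] -/
theorem aRange_disjoint (X : ℕ) {i j : ℕ} (hij : i ≠ j) :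
    Disjoint (aRange (tscale X i)) (aRange (tscale X j)) := by
  wlog hlt : i < j generalizing i j
  · exact (this hij.symm (lt_of_le_of_ne (not_lt.1 hlt) hij.symm)).symm
  rw [Finset.disjoint_left]
  intro a hai haj
  have hi := tscale_nonneg X i
  have hj := tscale_nonneg X j
  obtain ⟨h1, -⟩ := mem_aRange hi hai
  obtain ⟨-, h2⟩ := mem_aRange hj haj
  have h3 := tscale_succ_le X hlt
  nlinarith

/-- **The generator sum splits** over scales, pairs and `c`:
`∑_{α ∈ gens} g(α) = ∑_{i} ∑_{(a,b) ∈ P_i} ∑_{c ∈ 𝒞(a,b)} g(a,b,c)`.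
[cite: HeathBrown2001LargestPrimeFactorCubic, §4 p. 570] -/
theorem sum_gens_eq {X : ℕ} {P : ℕ → Finset (ℕ × ℕ)} (hP : ∀ i, P i ⊆ basePairs X i)
    (g : ℕ × ℕ × ℕ → ℝ) :
    ∑ v ∈ gens X P, g v =
      ∑ i ∈ scales X, ∑ ab ∈ P i, ∑ c ∈ cSet (tscale X i) ab.1 ab.2, g (ab.1, ab.2, c) := by
  classical
  rw [gens, sum_biUnion]
  · refine sum_congr rfl (fun i _ => ?_)
    rw [gensAt, sum_biUnion]
    · refine sum_congr rfl (fun ab _ => ?_)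
      rw [sum_image]
      intro c _ c' _ h
      simpa using h
    · -- distinct pairs give disjoint images
      intro ab _ ab' _ hne
      rw [Function.onFun, Finset.disjoint_left]
      intro v hv hv'
      rw [mem_image] at hv hv'
      obtain ⟨c, -, rfl⟩ := hv
      obtain ⟨c', -, h⟩ := hv'
      apply hne
      obtain ⟨a, b⟩ := ab
      obtain ⟨a', b'⟩ := ab'
      simp only [Prod.mk.injEq] at h ⊢
      exact ⟨h.1.symm, h.2.1.symm⟩
  · -- distinct scales give disjoint generator sets
    intro i hi j hj hne
    rw [Function.onFun, Finset.disjoint_left]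
    intro v hv hv'
    rw [mem_gensAt] at hv hv'
    have ha : v.1 ∈ aRange (tscale X i) := (mem_product.1 (mem_filter.1 (hP i hv.1)).1).1
    have ha' : v.1 ∈ aRange (tscale X j) := (mem_product.1 (mem_filter.1 (hP j hv'.1)).1).1
    exact Finset.disjoint_left.1 (aRange_disjoint X hne) ha ha'

/-- The filtered version: `∑_{α ∈ gens, Q(α)} g(α) = ∑_i ∑_{(a,b)} ∑_{c ∈ 𝒞, Q(a,b,c)} g(a,b,c)`.
[cite: HeathBrown2001LargestPrimeFactorCubic, §4 p. 570] -/
theorem sum_gens_filter_eq {X : ℕ} {P : ℕ → Finset (ℕ × ℕ)} (hP : ∀ i, P i ⊆ basePairs X i)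
    (Q : ℕ × ℕ × ℕ → Prop) [DecidablePred Q] (g : ℕ × ℕ × ℕ → ℝ) :
    ∑ v ∈ (gens X P).filter Q, g v =
      ∑ i ∈ scales X, ∑ ab ∈ P i,
        ∑ c ∈ (cSet (tscale X i) ab.1 ab.2).filter (fun c => Q (ab.1, ab.2, c)), g (ab.1, ab.2, c) := by
  rw [sum_filter, sum_gens_eq hP]
  refine sum_congr rfl (fun i _ => sum_congr rfl (fun ab _ => ?_))
  rw [sum_filter]

/-! ### Step 4: root classes -/

/-- **The `c`-sum by root classes** (p. 570, "`KA ∣ a + b∛2 + c∛4` … equivalent to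
`c ≡ c₁ (mod N(KA))`"): for an admissible pair `(a, b)` at scale `i` and `e ≥ 1`,
`∑_{c ∈ 𝒞(a,b), e ∣ N(a,b,c)} g(c) = ∑_{j ∈ roots(e)} ∑_{c ∈ 𝒞(a,b), e ∣ a + bj + cj²} g(c)`.
[cite: HeathBrown2001LargestPrimeFactorCubic, §4 (4.2)–(4.3)] -/
theorem sum_cSet_filter_dvd_eq {X : ℕ} {P : ℕ → Finset (ℕ × ℕ)} (hP : ∀ i, P i ⊆ basePairs X i)
    {i : ℕ} (hi : i ∈ scales X) {ab : ℕ × ℕ} (hab : ab ∈ P i) {e : ℕ} (he : 0 < e) (g : ℕ → ℝ) :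
    ∑ c ∈ (cSet (tscale X i) ab.1 ab.2).filter (fun c => e ∣ normNat (ab.1, ab.2, c)), g c =
      ∑ j ∈ roots e, ∑ c ∈ (cSet (tscale X i) ab.1 ab.2).filter
        (fun c : ℕ => (e : ℤ) ∣ (ab.1 : ℤ) + ab.2 * j + (c : ℤ) * (j : ℤ) ^ 2), g c := by
  obtain ⟨a, b⟩ := ab
  have hρ : ∀ c ∈ cSet (tscale X i) a b, ∃ m : ℤ,
      θint - (m : 𝓞 K) ∈ Ideal.span {coordElt ((a : ℤ), (b : ℤ), ((c : ℕ) : ℤ))} := by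
    intro c hc
    have hv : (a, b, c) ∈ gens X P := mem_gens.2 ⟨i, hi, hab, hc⟩
    obtain ⟨u, -, hu, -⟩ := exists_root_of_mem_gens hP hv
    exact ⟨_, hu⟩
  have h := sum_filter_dvd_absNorm_eq (cSet (tscale X i) a b) (fun c : ℕ => (c : ℤ)) hρ he g
  have hfilt : ((cSet (tscale X i) a b).filter fun c => e ∣ normNat (a, b, c)) =
      (cSet (tscale X i) a b).filter fun c =>
        e ∣ Ideal.absNorm (Ideal.span {coordElt ((a : ℤ), (b : ℤ), ((c : ℕ) : ℤ))}) := by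
    refine filter_congr (fun c _ => ?_)
    rw [← absNorm_genIdeal]; rfl
  rw [hfilt, h, roots]

/-! ### The identity and the bound (5.1) -/

/-- **`S₁` reorganised** (§4 (4.4) in rational form):
`S₁ = ∑_{d ∣ Q} λ_d ∑_{p ∈ 𝒦} ∑_i ∑_{(a,b) ∈ P_i} ∑_{j ∈ roots(pd)} ∑_{c ∈ 𝒞(a,b), pd ∣ a+bj+cj²} R_{(a,b,c)}`.
[cite: HeathBrown2001LargestPrimeFactorCubic, §4 (4.4)] -/
theorem S1sum_eq {X : ℕ} {P : ℕ → Finset (ℕ × ℕ)} (hP : ∀ i, P i ⊆ basePairs X i) :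
    S1sum X P = ∑ d ∈ (sievePrimes X).divisors, lam X d *
      ∑ p ∈ kPrimes X, ∑ i ∈ scales X, ∑ ab ∈ P i, ∑ j ∈ roots (p * d),
        ∑ c ∈ (cSet (tscale X i) ab.1 ab.2).filter
          (fun c : ℕ => ((p * d : ℕ) : ℤ) ∣ (ab.1 : ℤ) + ab.2 * j + (c : ℤ) * (j : ℤ) ^ 2),
          Rv X (ab.1, ab.2, c) := by
  classical
  rw [S1sum_eq_sum_divisors]
  refine sum_congr rfl (fun d hd => ?_)
  congr 1
  rw [sum_pairsVP_filter_eq]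
  refine sum_congr rfl (fun p hp => ?_)
  have hp0 : 0 < p := (mem_kPrimes hp).1.pos
  have hd0 : 0 < d := Nat.pos_of_mem_divisors hd
  rw [sum_gens_filter_eq hP]
  refine sum_congr rfl (fun i hi => sum_congr rfl (fun ab hab => ?_))
  exact sum_cSet_filter_dvd_eq hP hi hab (Nat.mul_pos hp0 hd0) (fun c => Rv X (ab.1, ab.2, c))

/-- **(5.1)**: `|S₁| ≤ ∑_{d ∣ Q} |λ_d| ∑_{p ∈ 𝒦} ∑_i ∑_{(a,b)} ∑_{j ∈ roots(pd)} |∑_{c : pd ∣ a+bj+cj²} R_{(a,b,c)}|`.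
[cite: HeathBrown2001LargestPrimeFactorCubic, (5.1)] -/
theorem abs_S1sum_le {X : ℕ} {P : ℕ → Finset (ℕ × ℕ)} (hP : ∀ i, P i ⊆ basePairs X i) :
    |S1sum X P| ≤ ∑ d ∈ (sievePrimes X).divisors, |lam X d| *
      ∑ p ∈ kPrimes X, ∑ i ∈ scales X, ∑ ab ∈ P i, ∑ j ∈ roots (p * d),
        |∑ c ∈ (cSet (tscale X i) ab.1 ab.2).filter
          (fun c : ℕ => ((p * d : ℕ) : ℤ) ∣ (ab.1 : ℤ) + ab.2 * j + (c : ℤ) * (j : ℤ) ^ 2),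
          Rv X (ab.1, ab.2, c)| := by
  rw [S1sum_eq hP]
  refine (abs_sum_le_sum_abs _ _).trans (sum_le_sum (fun d _ => ?_))
  rw [abs_mul]
  refine mul_le_mul_of_nonneg_left ?_ (abs_nonneg _)
  refine (abs_sum_le_sum_abs _ _).trans (sum_le_sum (fun p _ => ?_))
  refine (abs_sum_le_sum_abs _ _).trans (sum_le_sum (fun i _ => ?_))
  refine (abs_sum_le_sum_abs _ _).trans (sum_le_sum (fun ab _ => ?_))
  exact abs_sum_le_sum_abs _ _

end Literature.NumberTheory.Sieve.LargestPrimeFactorCubic
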